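import Literature.Topology.FourManifolds.RegularLevelSplitting
import Literature.Topology.FourManifolds.NiceMorseFunctionsProofs
import Literature.Topology.FourManifolds.HandlebodySplitting
import Literature.Topology.FourManifolds.MorseProofs
import Summits.SmoothPoincare4.SmoothPoincare4.Theorems.ConvexBisectionContractibleTwistedDoubleStandardStubPropertyRClosing
import HarnessLib

/-!
# A closed `4`-manifold with a Morse function of profile `(1,0,1,1,1)` is `S⁴` (modulo Property R and Laudenbach–Poénaru)

Helper file of line `property-r-mazur-halves` for crux `ConvexBisection.ContractibleTwistedDoubleStandard`
(item stmt-SmoothPoincare4-3546, route route-SmoothPoincare4-ConvexBisection).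

**Theorem** (`sphere_of_isMorse_oneZeroOneOneOne`).  GIVEN the two named facts of the line's
fact-stub `stub_factPropertyRClosingPair` — Laudenbach–Poénaru's extension theorem
(`Literature.Topology.FourManifolds.exists_diffeomorph_comp_incl_eq.{0}`) and the Property R closing
(`Literature.Topology.FourManifolds.propertyR_exists_isBoundaryGluing_sphere_four`, Gabai 1987 Cor. 8.3 +
Gompf–Scharlemann–Thompson 2010 Prop. 2.2) — every closed orientable smooth `4`-manifold `X` carrying
a Morse function with exactly `1, 0, 1, 1, 1` critical points of index `0, 1, 2, 3, 4` is
diffeomorphic to `S⁴`.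

Proof (Kirby 1989, Ch. I §2; Gompf–Stipsicz 1999, §4.4 "no `1`-handles and one `2`-handle").
By Milnor's final rearrangement theorem (Milnor 1965, Thm. 4.8, PROVED in the tree:
`exists_isSelfIndexing_criticalSet_eq_holds`) replace the function by a self-indexing one with the
same critical points and indices; the level `5/2` is then regular and separates the critical points
of index `≤ 2` from those of index `≥ 3` (`IsSelfIndexing.apply_ne_add_half`).  The sublevel set
`P = {F ≤ 5/2}` is a compact `4`-manifold with boundary carrying the adapted Morse function
`F|P - 3/2` with one critical point of index `0`, none of index `1`, one of index `2`
(`RegularSublevel.morseData`, `RegularSublevel.ncard_criticalSetOfIndex`; Milnor 1963, Thm. 3.1); the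
superlevel set `V = {5/2 ≤ F}`, read through the turned-about function `7/2 - F`, is a compact
connected orientable `(1,1)`-handlebody (indices `4 - i`, `IsMorse.criticalSetOfIndex_const_sub`;
connected by Reeb's argument `RegularSublevel.connectedSpace_superlevel`; orientable as a regular
domain of the orientable `X`, `RegularSublevel.isOrientable`); and `X = P ∪ V` along the level
(`RegularSublevel.isBoundaryGluing_split`).  The landed stub `stub_propertyRClosing` (p93313: Property R
makes `P ≅ S² × D²`, Laudenbach–Poénaru closes) gives `X ≅ S⁴`.

This is the closed-manifold form of the Property-R end of the line; it is consumed by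
`ConvexBisectionContractibleTwistedDoubleStandardBallSectorPropertyR.lean` (the sectors of the crux
with a ball half, WITHOUT Eliashberg's filling theorem or Cerf's `Γ₄ = 0`).

References: R. C. Kirby, *The topology of 4-manifolds*, LNM 1374 (1989), Ch. I §2; J. Milnor,
*Lectures on the h-cobordism theorem* (1965), Thm. 4.8, Def. 4.9, Lemma 2.9; J. Milnor, *Morse
theory* (1963), Thms. 3.1–3.2; D. Gabai, J. Differential Geom. 26 (1987), Cor. 8.3; F. Laudenbach,
V. Poénaru, Bull. SMF 100 (1972), Thm. A.
-/

noncomputable section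

-- the prescribed namespace `Summit.<P>.<Sub>.…` duplicates `SmoothPoincare4` (P = Sub)
set_option linter.dupNamespace false

open scoped Manifold ContDiff Topology
open Set Function Literature.Topology.FourManifolds

namespace Summit.SmoothPoincare4.SmoothPoincare4.Theorems.ContractibleTwistedDoubleStandard.PropertyRMazurHalves

section Halves

variable {X : Type} [TopologicalSpace X] [T2Space X] [SecondCountableTopology X] [CompactSpace X]
  [ChartedSpace (EuclideanSpace ℝ (Fin 4)) X] [IsManifold (𝓡 4) ∞ X] {f : X → ℝ} {c : ℝ}

omit [T2Space X] [SecondCountableTopology X] in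
/-- **The lower half `{f ≤ c}` is a `(1,0,1)`-handlebody, explicit form.**  For a Morse function on
a closed `4`-manifold with `1, 0, 1` critical points of index `0, 1, 2`, all strictly below the
regular level `c`, and all critical points of index `≥ 3` strictly above it, the adapted Morse
function `f|{f ≤ c} + (1 - c)` (Milnor 1963, Thm. 3.1) has all indices `≤ 2`, exactly one critical
point of index `0`, none of index `1` and one of index `2`. [cite: Milnor1963, Thms. 3.1–3.2] -/
theorem regularSublevel_oneZeroOne (hf : IsMorse (𝓡 4) f) (h : IsRegularLevel (𝓡 4) f c)
    (h0 : (criticalSetOfIndex (𝓡 4) f 0).ncard = 1) (h1 : (criticalSetOfIndex (𝓡 4) f 1).ncard = 0)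
    (h2 : (criticalSetOfIndex (𝓡 4) f 2).ncard = 1)
    (hbelow : ∀ x, IsMCriticalPt (𝓡 4) f x → morseIndex (𝓡 4) f x ≤ 2 → f x < c)
    (habove : ∀ x, IsMCriticalPt (𝓡 4) f x → 3 ≤ morseIndex (𝓡 4) f x → c < f x) :
    IsMorseAdapted (𝓡∂ 4) (fun x : RegularSublevel h => f (RegularSublevel.incl h x) + (1 - c)) ∧
    (∀ z, IsMCriticalPt (𝓡∂ 4) (fun x : RegularSublevel h => f (RegularSublevel.incl h x) + (1 - c)) z →
      morseIndex (𝓡∂ 4) (fun x : RegularSublevel h => f (RegularSublevel.incl h x) + (1 - c)) z ≤ 2) ∧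
    (criticalSetOfIndex (𝓡∂ 4)
        (fun x : RegularSublevel h => f (RegularSublevel.incl h x) + (1 - c)) 0).ncard = 1 ∧
    criticalSetOfIndex (𝓡∂ 4)
        (fun x : RegularSublevel h => f (RegularSublevel.incl h x) + (1 - c)) 1 = ∅ ∧
    (criticalSetOfIndex (𝓡∂ 4)
        (fun x : RegularSublevel h => f (RegularSublevel.incl h x) + (1 - c)) 2).ncard = 1 := by
  obtain ⟨had, hcrit, hind⟩ := RegularSublevel.morseData hf h
  have hcount := RegularSublevel.ncard_criticalSetOfIndex hf h
  -- below `c` the critical points of index `i ≤ 2` are all of them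
  have hfull : ∀ {i : ℕ}, i ≤ 2 →
      criticalSetOfIndex (𝓡 4) f i ∩ f ⁻¹' Iic c = criticalSetOfIndex (𝓡 4) f i := fun {i} hi => by
    refine inter_eq_left.2 fun x hx => ?_
    exact (hbelow x hx.1 (by rw [hx.2]; exact hi)).le
  refine ⟨had, fun z hz => ?_, ?_, ?_, ?_⟩
  · -- indices on the lower half are `≤ 2`
    have hz' : IsMCriticalPt (𝓡 4) f (RegularSublevel.incl h z) := (hcrit z).1 hz
    rw [hind z hz']
    change morseIndex (𝓡 4) f (RegularSublevel.incl h z) ≤ 2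
    by_contra hgt
    have h3 : 3 ≤ morseIndex (𝓡 4) f (RegularSublevel.incl h z) := by omega
    have hlt := habove _ hz' h3
    exact absurd (RegularSublevel.apply_incl_le h z) (not_le.2 hlt)
  · rw [hcount 0, hfull (by norm_num), h0]
  · have hfin : (criticalSetOfIndex (𝓡∂ 4)
        (fun x : RegularSublevel h => f (RegularSublevel.incl h x) + (1 - c)) 1).Finite :=
      (IsMorse.finite_criticalSet_holds had.isMorse).subset (criticalSetOfIndex_subset _ _ _)
    rw [← Set.ncard_eq_zero hfin, hcount 1, hfull (by norm_num), h1]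
  · rw [hcount 2, hfull (by norm_num), h2]

omit [T2Space X] [SecondCountableTopology X] in
/-- **The upper half `{c ≤ f}` is a compact connected `(1,1)`-handlebody, explicit form.**  With
`1, 1` critical points of index `3, 4` strictly above the regular level `c` and those of index `≤ 2`
strictly below, the adapted Morse function `(c - f)|{c ≤ f} + 1` of the superlevel set (Milnor's
turn-about) has indices `≤ 1`, one critical point of index `0` and one of index `1`
(`IsMorse.criticalSetOfIndex_const_sub`), and `{c ≤ f}` is connected (Reeb's argument).
[cite: Milnor1963, Thms. 3.1–3.2] [cite: MilnorHCobordism1965, proof of Thm. 9.1] -/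
theorem regularSuperlevel_oneOne (hf : IsMorse (𝓡 4) f) (h : IsRegularLevel (𝓡 4) f c)
    (h3 : (criticalSetOfIndex (𝓡 4) f 3).ncard = 1) (h4 : (criticalSetOfIndex (𝓡 4) f 4).ncard = 1)
    (hbelow : ∀ x, IsMCriticalPt (𝓡 4) f x → morseIndex (𝓡 4) f x ≤ 2 → f x < c)
    (habove : ∀ x, IsMCriticalPt (𝓡 4) f x → 3 ≤ morseIndex (𝓡 4) f x → c < f x) :
    (∃ g : RegularSuperlevel h → ℝ, IsMorseAdapted (𝓡∂ 4) g ∧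
        (∀ z, IsMCriticalPt (𝓡∂ 4) g z → morseIndex (𝓡∂ 4) g z ≤ 1) ∧
        (criticalSetOfIndex (𝓡∂ 4) g 0).ncard = 1 ∧ (criticalSetOfIndex (𝓡∂ 4) g 1).ncard = 1) ∧
    ConnectedSpace (RegularSuperlevel h) := by
  have hg : IsMorse (𝓡 4) (fun y => c - f y) := hf.const_sub c
  obtain ⟨had, hcrit, hind⟩ := RegularSublevel.morseData hg h.const_sub
  have hcount := RegularSublevel.ncard_criticalSetOfIndex hg h.const_sub
  have hrank : Module.finrank ℝ (EuclideanSpace ℝ (Fin 4)) = 4 := finrank_euclideanSpace_fin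
  have hfd : ∀ x, MDifferentiableAt (𝓡 4) 𝓘(ℝ, ℝ) f x := fun x =>
    hf.contMDiff.mdifferentiableAt (by simp)
  have hcs : ∀ {i : ℕ}, i ≤ 4 → criticalSetOfIndex (𝓡 4) (fun y => c - f y) i =
      criticalSetOfIndex (𝓡 4) f (4 - i) := fun {i} hi => by
    rw [hf.criticalSetOfIndex_const_sub c (by rw [hrank]; exact hi), hrank]
  -- above `c` (i.e. below the level `0` of `c - f`) the critical points of index `j ≥ 3` are all of them
  have hfull : ∀ {j : ℕ}, 3 ≤ j → criticalSetOfIndex (𝓡 4) f j ∩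
      (fun y => c - f y) ⁻¹' Iic (0 : ℝ) = criticalSetOfIndex (𝓡 4) f j := fun {j} hj => by
    refine inter_eq_left.2 fun x hx => ?_
    have h2 := habove x hx.1 (by rw [hx.2]; exact hj)
    show c - f x ≤ 0
    linarith
  refine ⟨⟨_, had, fun z hz => ?_, ?_, ?_⟩, ?_⟩
  · -- indices on the upper half are `≤ 1`
    set x := RegularSublevel.incl h.const_sub z with hx
    have hz' : IsMCriticalPt (𝓡 4) (fun y => c - f y) x := (hcrit z).1 hz
    have hzf : IsMCriticalPt (𝓡 4) f x := (isMCriticalPt_const_sub_iff c (hfd x)).1 hz'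
    rw [hind z hz', ← hx]
    change morseIndex (𝓡 4) (fun y => c - f y) x ≤ 1
    have hsum : morseIndex (𝓡 4) (fun y => c - f y) x + morseIndex (𝓡 4) f x = 4 := by
      simpa [hrank] using hf.morseIndex_const_sub_add c hzf
    have hle : c - f x ≤ 0 := RegularSublevel.apply_incl_le h.const_sub z
    by_contra hgt
    have hi : morseIndex (𝓡 4) f x ≤ 2 := by omega
    have hlt := hbelow x hzf hi
    linarith
  · rw [hcount 0, hcs (by norm_num), show (4 : ℕ) - 0 = 4 from rfl, hfull (by norm_num), h4]
  · rw [hcount 1, hcs (by norm_num), show (4 : ℕ) - 1 = 3 from rfl, hfull (by norm_num), h3]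
  · -- connectedness: one critical point of top index, above `c`
    obtain ⟨x₄, hx₄⟩ := Set.ncard_eq_one.1 h4
    have hmem : x₄ ∈ criticalSetOfIndex (𝓡 4) f 4 := by rw [hx₄]; exact mem_singleton _
    have h4' : (criticalSetOfIndex (𝓡 4) f (3 + 1)).Subsingleton := by
      rw [show (3 : ℕ) + 1 = 4 from rfl, hx₄]; exact subsingleton_singleton
    exact RegularSublevel.connectedSpace_superlevel hf h h4'
      ⟨x₄, (habove x₄ hmem.1 (by rw [hmem.2]; norm_num)).le⟩

end Halves

/-- **A closed orientable smooth `4`-manifold with a Morse function of profile `(1,0,1,1,1)` is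
diffeomorphic to `S⁴`, GRANTED Laudenbach–Poénaru (`exists_diffeomorph_comp_incl_eq.{0}`) and the
Property R closing (`propertyR_exists_isBoundaryGluing_sphere_four`).**  Rearrange to a self-indexing
Morse function with the same critical points and indices (Milnor 1965, Thm. 4.8, proved in the tree),
split at the regular level `5/2` into the `(1,0,1)`-handlebody `P = {F ≤ 5/2}` and the compact
connected orientable `(1,1)`-handlebody `V = {5/2 ≤ F}` (`regularSublevel_oneZeroOne`,
`regularSuperlevel_oneOne`, `RegularSublevel.isOrientable`, `RegularSublevel.isBoundaryGluing_split`),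
and close with the landed `stub_propertyRClosing` (Property R: `P ≅ S² × D²`; Laudenbach–Poénaru).
[cite: Kirby1989, Ch. I §2, p. 8] [cite: MilnorHCobordism1965, Thm. 4.8 and Lemma 2.9]
[cite: GabaiJDG1987, Cor. 8.3] [cite: LaudenbachPoenaruBSMF1972, Thm. A] -/
theorem sphere_of_isMorse_oneZeroOneOneOne
    (hLP : exists_diffeomorph_comp_incl_eq.{0}) (hR : propertyR_exists_isBoundaryGluing_sphere_four)
    (X : Type) [TopologicalSpace X] [T2Space X] [SecondCountableTopology X] [CompactSpace X]
    [ChartedSpace (EuclideanSpace ℝ (Fin 4)) X] [IsManifold (𝓡 4) ∞ X]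
    (hXo : IsOrientable (𝓡 4) X) {F : X → ℝ} (hF : IsMorse (𝓡 4) F)
    (h0 : (criticalSetOfIndex (𝓡 4) F 0).ncard = 1) (h1 : (criticalSetOfIndex (𝓡 4) F 1).ncard = 0)
    (h2 : (criticalSetOfIndex (𝓡 4) F 2).ncard = 1) (h3 : (criticalSetOfIndex (𝓡 4) F 3).ncard = 1)
    (h4 : (criticalSetOfIndex (𝓡 4) F 4).ncard = 1) :
    Nonempty (X ≃ₘ⟮𝓡 4, 𝓡 4⟯ Metric.sphere (0 : EuclideanSpace ℝ (Fin 5)) 1) := by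
  -- Milnor's final rearrangement: a self-indexing Morse function with the same critical data
  obtain ⟨G, hG, hsi, hcrit, hidx⟩ := exists_isSelfIndexing_criticalSet_eq_holds 4 X F hF
  have hsame : ∀ i, criticalSetOfIndex (𝓡 4) G i = criticalSetOfIndex (𝓡 4) F i := fun i => by
    ext x
    simp only [mem_criticalSetOfIndex]
    constructor
    · rintro ⟨hx, hxi⟩
      have hxF : x ∈ criticalSet (𝓡 4) F := by rw [← hcrit]; exact hx
      exact ⟨hxF, by rw [← hidx x hxF]; exact hxi⟩
    · rintro ⟨hx, hxi⟩
      have hxG : x ∈ criticalSet (𝓡 4) G := by rw [hcrit]; exact hx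
      exact ⟨hxG, by rw [hidx x hx]; exact hxi⟩
  -- the level `5/2` is regular and separates index `≤ 2` from index `≥ 3`
  set c : ℝ := (2 : ℕ) + 1 / 2 with hc
  have hne : ∀ z, IsMCriticalPt (𝓡 4) G z → G z ≠ c := fun z hz => hsi.apply_ne_add_half 2 hz
  have h : IsRegularLevel (𝓡 4) G c := hG.isRegularLevel hne
  have hbelow : ∀ x, IsMCriticalPt (𝓡 4) G x → morseIndex (𝓡 4) G x ≤ 2 → G x < c := by
    intro x hx hi
    rw [hsi x hx, hc]
    have : (morseIndex (𝓡 4) G x : ℝ) ≤ 2 := by exact_mod_cast hi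
    push_cast
    linarith
  have habove : ∀ x, IsMCriticalPt (𝓡 4) G x → 3 ≤ morseIndex (𝓡 4) G x → c < G x := by
    intro x hx hi
    rw [hsi x hx, hc]
    have : (3 : ℝ) ≤ (morseIndex (𝓡 4) G x : ℝ) := by exact_mod_cast hi
    push_cast
    linarith
  rw [← hsame 0] at h0
  rw [← hsame 1] at h1
  rw [← hsame 2] at h2
  rw [← hsame 3] at h3
  rw [← hsame 4] at h4
  -- the two halves
  obtain ⟨hadP, hiP, h0P, h1P, h2P⟩ := regularSublevel_oneZeroOne hG h h0 h1 h2 hbelow habove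
  obtain ⟨hV, hconn⟩ := regularSuperlevel_oneOne hG h h3 h4 hbelow habove
  haveI : ConnectedSpace (RegularSuperlevel h) := hconn
  have hVo : IsOrientable (𝓡∂ 4) (RegularSuperlevel h) := RegularSublevel.isOrientable h.const_sub hXo
  -- Property R + Laudenbach–Poénaru
  exact stub_propertyRClosing hLP hR (RegularSublevel h) _ hadP hiP h0P h1P h2P (RegularSuperlevel h)
    hV hVo (RegularSublevel.boundaryData h) (RegularSublevel.boundaryData h.const_sub)
    (RegularSublevel.splitDiffeomorph h) X (RegularSublevel.isBoundaryGluing_split h)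

/-- **Stub `stub_closedOneZeroOne` of skeleton m6 (registered form of
`sphere_of_isMorse_oneZeroOneOneOne`).**  GIVEN Laudenbach–Poénaru and the Property R closing, a
closed orientable smooth `4`-manifold with a Morse function of profile `(1,0,1,1,1)` is `S⁴`.
[cite: Kirby1989, Ch. I §2, p. 8] [cite: GabaiJDG1987, Cor. 8.3] [cite: LaudenbachPoenaruBSMF1972, Thm. A] -/
theorem stub_closedOneZeroOne :
    exists_diffeomorph_comp_incl_eq.{0} → propertyR_exists_isBoundaryGluing_sphere_four →
    ∀ (X : Type) [TopologicalSpace X] [T2Space X] [SecondCountableTopology X] [CompactSpace X]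
      [ChartedSpace (EuclideanSpace ℝ (Fin 4)) X] [IsManifold (𝓡 4) ∞ X],
      IsOrientable (𝓡 4) X → ∀ (F : X → ℝ), IsMorse (𝓡 4) F →
      (criticalSetOfIndex (𝓡 4) F 0).ncard = 1 → (criticalSetOfIndex (𝓡 4) F 1).ncard = 0 →
      (criticalSetOfIndex (𝓡 4) F 2).ncard = 1 → (criticalSetOfIndex (𝓡 4) F 3).ncard = 1 →
      (criticalSetOfIndex (𝓡 4) F 4).ncard = 1 →
      Nonempty (X ≃ₘ⟮𝓡 4, 𝓡 4⟯ Metric.sphere (0 : EuclideanSpace ℝ (Fin 5)) 1) :=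
  fun hLP hR X _ _ _ _ _ _ hXo _ hF h0 h1 h2 h3 h4 =>
    sphere_of_isMorse_oneZeroOneOneOne hLP hR X hXo hF h0 h1 h2 h3 h4

end Summit.SmoothPoincare4.SmoothPoincare4.Theorems.ContractibleTwistedDoubleStandard.PropertyRMazurHalves

end
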